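import Mathlib
import HarnessLib
import Literature.Computability.AlgebraicComplexity.MonotoneStructure
import Literature.Computability.AlgebraicComplexity.PermanentIrreducible
import Literature.Barriers.ValiantsHypothesis.MonotoneGapPermanentLower

/-!
# ValiantsHypothesis / MonotoneRestoration — `MonotoneRestorationQP`, line `Sketch`, stub B2

Support file for crux item `stmt-ValiantsHypothesis-15886`
(`Summit.ValiantsHypothesis.ValiantsHypothesis.Theses.MonotoneRestoration.MonotoneRestorationQP`),
line `Sketch`, stub `stub_permSupport_decomposition_count` (Jerrum–Snir's partition count).

If a polynomial `q` over `ℝ≥0` in the `k × k` matrix variables is supported on exactly the `k!`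
permutation monomials and `q = Σ_{t ∈ L} a_t · b_t` with `a_t` ordered with a row set `A_t`,
`k/3 < |A_t| ≤ 2k/3`, and `a_t b_t ≤ q` coefficientwise, then `2 ^ k ≤ |L| ^ 3`.

Proof (Jerrum–Snir 1982, §4.3): `supp q ⊆ ⋃_t supp (a_t b_t)`, so `k! ≤ Σ_t |supp (a_t b_t)|`;
`|supp (a_t b_t)| ≤ |supp a_t| · |supp b_t|`; every `a + b₀` (`a ∈ supp a_t`, `b₀ ∈ supp b_t`
fixed) is a permutation monomial (no cancellation over `ℝ≥0` and domination), so the tree's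
partition lemma `JerrumSnir.card_le_factorial_of_add_mem` gives `|supp a_t| ≤ (deg a₀)!`,
`|supp b_t| ≤ (deg b₀)!`, `deg a₀ + deg b₀ = k`, and `deg a₀ = |A_t|` by orderedness. With
`m₀ = ⌊(k+2)/3⌋ ≤ min (|A_t|, k - |A_t|)` and `2 ^ m ≤ C(k, m)` for `2m ≤ k` one gets
`|A_t|! (k - |A_t|)! 2^{m₀} ≤ k!`, hence `k! 2^{m₀} ≤ |L| k!`, `2^{m₀} ≤ |L|`, and
`2^k ≤ 2^{3 m₀} ≤ |L|^3`.
-/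

-- `Summit.ValiantsHypothesis.ValiantsHypothesis.…` is the tree's mandated single-conjunct layout
-- (Sub = Summit), so the duplicated namespace component is intended.
set_option linter.dupNamespace false

noncomputable section

namespace Summit.ValiantsHypothesis.ValiantsHypothesis.Theorems

open Literature.Computability.AlgebraicComplexity MvPolynomial
open scoped NNReal Pointwise

/-- The support of a sum of a list of polynomials has at most as many monomials as the supports of
the summands together. [folklore] -/
theorem permSupportCount_card_support_sum_map_le {α σ R : Type*} [CommSemiring R]
    (f : α → MvPolynomial σ R) (L : List α) :
    (L.map f).sum.support.card ≤ (L.map fun x => (f x).support.card).sum := by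
  classical
  induction L with
  | nil => simp
  | cons x L ih =>
    simp only [List.map_cons, List.sum_cons]
    exact (Finset.card_le_card support_add).trans
      ((Finset.card_union_le _ _).trans (Nat.add_le_add_left ih _))

/-- `2 ^ s ≤ C(k, s)` whenever `2 s ≤ k` (Pascal's rule twice). [folklore] -/
theorem permSupportCount_two_pow_le_choose :
    ∀ (s k : ℕ), 2 * s ≤ k → 2 ^ s ≤ Nat.choose k s
  | 0, k, _ => by simp
  | s + 1, k, h => by
    obtain ⟨j, rfl⟩ : ∃ j, k = j + 2 := ⟨k - 2, by omega⟩
    have h1 := permSupportCount_two_pow_le_choose s (j + 1) (by omega)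
    have h2 := permSupportCount_two_pow_le_choose s j (by omega)
    have h3 : (j + 2).choose (s + 1) = (j + 1).choose s + (j.choose s + j.choose (s + 1)) := by
      rw [Nat.choose_succ_succ', Nat.choose_succ_succ']
    have h4 : 2 ^ (s + 1) = 2 * 2 ^ s := pow_succ' 2 s
    omega

/-- The balanced binomial bound: if `k < 3 s` and `3 s ≤ 2 k` then
`s! (k - s)! 2^{⌊(k+2)/3⌋} ≤ k!`. [folklore] -/
theorem permSupportCount_factorial_mul_two_pow_le {k s : ℕ} (h1 : k < 3 * s)
    (h2 : 3 * s ≤ 2 * k) :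
    s.factorial * (k - s).factorial * 2 ^ ((k + 2) / 3) ≤ k.factorial := by
  have hs : s ≤ k := by omega
  have hchoose : 2 ^ ((k + 2) / 3) ≤ Nat.choose k s := by
    by_cases hsk : 2 * s ≤ k
    · exact (Nat.pow_le_pow_right (by norm_num) (by omega)).trans
        (permSupportCount_two_pow_le_choose s k hsk)
    · rw [← Nat.choose_symm hs]
      exact (Nat.pow_le_pow_right (by norm_num) (by omega)).trans
        (permSupportCount_two_pow_le_choose (k - s) k (by omega))
  calc s.factorial * (k - s).factorial * 2 ^ ((k + 2) / 3)
      ≤ s.factorial * (k - s).factorial * Nat.choose k s := Nat.mul_le_mul_left _ hchoose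
    _ = k.factorial := by
      rw [← Nat.choose_mul_factorial_mul_factorial hs]
      ring

/-- **One term of the partition count.** If `q` is supported on the permutation monomials,
`a` is ordered with row set `A` and `a * b ≤ q` coefficientwise (over `ℝ≥0`), then
`|supp (a * b)| ≤ |A|! (k - |A|)!`: every `a' + b₀`, `a' ∈ supp a`, is a permutation monomial,
so `|supp a| ≤ (deg a₀)! = |A|!`, and symmetrically `|supp b| ≤ (k - |A|)!`.
[cite: JerrumSnir1982, §4.3] -/
theorem permSupportCount_card_support_mul_le {k : ℕ}
    {q : MvPolynomial (Fin k × Fin k) ℝ≥0}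
    (hq : ∀ m, m ∈ q.support ↔ ∃ π : Equiv.Perm (Fin k), permMonomial π = m)
    {A : Finset (Fin k)} {a b : MvPolynomial (Fin k × Fin k) ℝ≥0}
    (ha : IsOrdered A a) (hle : ∀ m, coeff m (a * b) ≤ coeff m q) :
    (a * b).support.card ≤ A.card.factorial * (k - A.card).factorial := by
  classical
  by_cases ha0 : a = 0
  · simp [ha0]
  by_cases hb0 : b = 0
  · simp [hb0]
  obtain ⟨a₀, ha₀⟩ := support_nonempty.2 ha0
  obtain ⟨b₀, hb₀⟩ := support_nonempty.2 hb0
  -- monomials of `a * b` are monomials of `q` (domination over `ℝ≥0`)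
  have hsub : ∀ m ∈ (a * b).support, m ∈ q.support := by
    intro m hm
    rw [mem_support_iff] at hm ⊢
    intro h0
    exact hm (le_antisymm ((hle m).trans h0.le) zero_le)
  have hA : ∀ a' ∈ a.support, ∃ σ : Equiv.Perm (Fin k), a' + b₀ = permMonomial σ := by
    intro a' ha'
    obtain ⟨σ, hσ⟩ := (hq _).1 (hsub _ (add_mem_support_mul ha' hb₀))
    exact ⟨σ, hσ.symm⟩
  have hB : ∀ b' ∈ b.support, ∃ σ : Equiv.Perm (Fin k), b' + a₀ = permMonomial σ := by
    intro b' hb'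
    obtain ⟨σ, hσ⟩ := (hq _).1 (hsub _ (add_mem_support_mul ha₀ hb'))
    exact ⟨σ, by rw [add_comm]; exact hσ.symm⟩
  obtain ⟨hca, hdeg⟩ :=
    Literature.Barriers.ValiantsHypothesis.JerrumSnir.card_le_factorial_of_add_mem hA ha₀
  obtain ⟨hcb, -⟩ :=
    Literature.Barriers.ValiantsHypothesis.JerrumSnir.card_le_factorial_of_add_mem hB hb₀
  -- `deg a₀ = |A|` by orderedness
  have hdegA : a₀.degree = A.card := by
    rw [← degree_rowDegrees, Finsupp.degree_eq_sum]
    simp_rw [ha a₀ ha₀]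
    rw [Finset.sum_boole]
    simp
  have hdegB : b₀.degree = k - A.card := by omega
  calc (a * b).support.card ≤ (a.support + b.support).card :=
        Finset.card_le_card (support_mul a b)
    _ ≤ a.support.card * b.support.card := Finset.card_add_le
    _ ≤ a₀.degree.factorial * b₀.degree.factorial := Nat.mul_le_mul hca hcb
    _ = A.card.factorial * (k - A.card).factorial := by rw [hdegA, hdegB]

/-- **B2 — Jerrum–Snir's partition count for a balanced decomposition.** If `q` over `ℝ≥0` is
supported on exactly the `k!` permutation monomials (`k ≥ 3`) and `q = Σ_{t ∈ L} a_t b_t` with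
`a_t` ordered with row set `A_t`, `b_t` ordered with `A_tᶜ`, `k < 3 |A_t|`, `3 |A_t| ≤ 2 k` and
`a_t b_t ≤ q` coefficientwise, then `2 ^ k ≤ |L| ^ 3`: each term covers at most
`|A_t|! (k - |A_t|)! ≤ k! / 2^{⌈k/3⌉}` of the `k!` monomials of `q`. (The registered
hypothesis `hk : 3 ≤ k` is carried but not needed: the bound holds for every `k`.)
[cite: JerrumSnir1982, §4.3] -/
theorem stub_permSupport_decomposition_count {k : ℕ} (hk : 3 ≤ k)
    {q : MvPolynomial (Fin k × Fin k) NNReal}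
    (hq : ∀ m, m ∈ q.support ↔ ∃ π : Equiv.Perm (Fin k), permMonomial π = m)
    (L : List (Finset (Fin k) × MvPolynomial (Fin k × Fin k) NNReal ×
      MvPolynomial (Fin k × Fin k) NNReal))
    (hsum : (L.map fun t => t.2.1 * t.2.2).sum = q)
    (hL : ∀ t ∈ L, IsOrdered t.1 t.2.1 ∧ IsOrdered t.1ᶜ t.2.2 ∧
      k < 3 * t.1.card ∧ 3 * t.1.card ≤ 2 * k ∧
      ∀ m, MvPolynomial.coeff m (t.2.1 * t.2.2) ≤ MvPolynomial.coeff m q) :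
    2 ^ k ≤ L.length ^ 3 := by
  classical
  -- `hk : 3 ≤ k` belongs to the registered signature; the count below holds for every `k`, so the
  -- hypothesis is only acknowledged here.
  have _ := hk
  -- `|supp q| = k!`
  have hcard : q.support.card = k.factorial := by
    have hs : q.support = Finset.univ.image permMonomial := by
      ext m
      simp [hq m, eq_comm]
    rw [hs, Finset.card_image_of_injective _ permMonomial_injective, Finset.card_univ,
      Fintype.card_perm, Fintype.card_fin]
  -- `k! ≤ Σ_t |supp (a_t b_t)|`
  have h1 : k.factorial ≤ (L.map fun t => (t.2.1 * t.2.2).support.card).sum := by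
    have h := permSupportCount_card_support_sum_map_le (fun t => t.2.1 * t.2.2) L
    rw [hsum, hcard] at h
    exact h
  -- each term: `|supp (a_t b_t)| · 2^{m₀} ≤ k!`
  have h2 : ∀ t ∈ L, (t.2.1 * t.2.2).support.card * 2 ^ ((k + 2) / 3) ≤ k.factorial := by
    intro t ht
    obtain ⟨hta, -, hlt, hle3, hle⟩ := hL t ht
    calc (t.2.1 * t.2.2).support.card * 2 ^ ((k + 2) / 3)
        ≤ t.1.card.factorial * (k - t.1.card).factorial * 2 ^ ((k + 2) / 3) :=
          Nat.mul_le_mul_right _ (permSupportCount_card_support_mul_le hq hta hle)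
      _ ≤ k.factorial := permSupportCount_factorial_mul_two_pow_le hlt hle3
  -- summing over `L`
  have h3 : 2 ^ ((k + 2) / 3) * k.factorial ≤ L.length * k.factorial := by
    calc 2 ^ ((k + 2) / 3) * k.factorial = k.factorial * 2 ^ ((k + 2) / 3) := mul_comm _ _
      _ ≤ (L.map fun t => (t.2.1 * t.2.2).support.card).sum * 2 ^ ((k + 2) / 3) :=
          Nat.mul_le_mul_right _ h1
      _ = (L.map fun t => (t.2.1 * t.2.2).support.card * 2 ^ ((k + 2) / 3)).sum := by
          rw [List.sum_map_mul_right]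
      _ ≤ L.length * k.factorial := by
          have h := List.sum_le_card_nsmul
            (L.map fun t => (t.2.1 * t.2.2).support.card * 2 ^ ((k + 2) / 3)) k.factorial
            (fun x hx => by
              obtain ⟨t, ht, rfl⟩ := List.mem_map.1 hx
              exact h2 t ht)
          rwa [List.length_map, smul_eq_mul] at h
  have h4 : 2 ^ ((k + 2) / 3) ≤ L.length :=
    Nat.le_of_mul_le_mul_right h3 (Nat.factorial_pos k)
  have hk3 : k ≤ 3 * ((k + 2) / 3) := by omega
  calc 2 ^ k ≤ 2 ^ (3 * ((k + 2) / 3)) := Nat.pow_le_pow_right (by norm_num) hk3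
    _ = (2 ^ ((k + 2) / 3)) ^ 3 := by rw [mul_comm, pow_mul]
    _ ≤ L.length ^ 3 := Nat.pow_le_pow_left h4 3

end Summit.ValiantsHypothesis.ValiantsHypothesis.Theorems
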